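import Summits.Langlands.Langlands.Theorems.SqrtFiveQuarticCoversBorelFiveX0FiveHauptmodul

/-!
# Route `SqrtFiveQuarticCovers` (crux `RefinedLocusModular`, stmt-Langlands-17833): the algebra and group
# law of the `X₀(7)` hauptmodul — a point of order `7` gives `u` with `c₄³·u = (u²+13u+49)(u²+5u+1)³·Δ`

Level-`7` analogue of `…BorelFiveX0FiveAlgebra` / `…X0FiveHauptmodul` (p800654/p800867).  RECORD v5's
MODEL input `hK1w` (certificate `CertH12B7`) has the conjunct `c₄³·u = (u²+13u+49)(u²+5u+1)³·Δ` — the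
uniformisation of `X₀(7) → X(1)` (Klein; FLS 2015 §2.2; Cremona–Freitas §3.6) — read off a `b7`-framing.
This file proves the point-level statement: for an affine point `P = (x, y)` of order `7` on a
Weierstrass curve over a field, an explicit `u ∈ K(x)` satisfies that equation.  Ingredients:

* the CHORD step `addX_chord_three`: `(x(3P) − x)·Ψ₃(x)² = −υ(x)·P₄(x)` (`x(3P) = x − ψ₂ψ₄/ψ₃²`), from
  Mathlib's group law with a 287-term cofactor of the curve equation;
* `order_seven_relation`: `7P = O` ⇒ `4P = −3P` ⇒ (two doublings against the chord)
  `R₇ := Ψ₃⁶ − Ψ₃³P₄υ² + P₄³υ² = 0` at `x(P)` (`R₇ = −Ψ₇`, since `ψ₇ = ψ₅ψ₃³ − ψ₂ψ₄³`);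
* Tate atoms: `d := Ψ₃³/(P₄υ²)` (`= b/c` of the Tate normal form, `X₁(7)`-coordinate), `R₇ ⇔ P₄ = υ²(d−d²)`,
  then `Ψ₃³ = υ⁴d²(1−d)`, `τΨ₃ = υ²(1+d−d²)`, `c₄Ψ₃⁴ = υ⁶·c₄ᵀ(d)`, `ΔΨ₃¹² = υ¹⁸·Δᵀ(d)` with
  `c₄ᵀ = (d²−d+1)(d⁶−11d⁵+30d⁴−15d³−10d²+5d+1)`, `Δᵀ = d⁷(d−1)⁷(d³−8d²+5d+1)`, and the hauptmodul
  `u = (d³ − 8d² + 5d + 1)/(d(d−1))` with the UNIVARIATE identity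
  `c₄ᵀ³·(d³−8d²+5d+1)·(d(d−1))⁷ = (Un²+13UnUd+49Ud²)(Un²+5UnUd+Ud²)³·Δᵀ`;
* `exists_X0_seven_hauptmodul_of_relation`: given those relations at `x` (with `d·P₄υ² = Ψ₃³`), `d ∉ {0,1}` and the equation `c₄³·u = (u²+13u+49)(u²+5u+1)³·Δ` in the field.

The Galois wrapper (`b7`-framing ⇒ `u ∈ K`, via `d(x(2P)) = (d−1)/d`) is the successor file.  Everything
is proved; no named fact.  HONEST STATUS: helper of stmt-Langlands-17833 toward its N1 debt; closes no
stub, moves no binder; nothing here proves modularity of any curve.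

References: J. H. Silverman, GTM 106 (2009), III.§2, Ex. 3.7; F. Klein, *Über die Transformation
siebenter Ordnung* (1878); [FreitasLeHungSiksek2015] §2.2; J. Cremona, N. Freitas, *Global methods for
the symplectic type of congruences between elliptic curves*, §3.6 (`X₀(7)`).
-/

noncomputable section

set_option linter.dupNamespace false -- project-wide option (lakefile weak.linter.dupNamespace); `Summit.Langlands.Langlands` is the mandated namespace

open scoped Classical

namespace Summit.Langlands.Langlands.Theorems.SqrtFiveQuarticCovers

open WeierstrassCurve Polynomial

/-- **The chord identity `x(3P) = x − ψ₂ψ₄/ψ₃²`.**  For an affine point `P = (x, y)` with `2P ≠ O` and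
`x(2P) ≠ x` (i.e. `3P ≠ O`), the abscissa `x₃` of `P + 2P` (Mathlib's chord `addX`) satisfies
`(x₃ − x)·Ψ₃(x)² = −υ(x)·P₄(x)`, `P₄ = τΨ₃ − υ²`.  Proof: Mathlib's slope/addX/addY formulas, the
tangent step `(x(2P) − x)ψ₂² = −Ψ₃` (tree), and a 287-term multiple of the curve equation.
[cite: SilvermanAEC2009, III.2.3, Ex. 3.7] -/
theorem addX_chord_three {L : Type*} [Field L] (W : WeierstrassCurve L) {x y : L}
    (h : W.toAffine.Nonsingular x y) (hy : y ≠ W.toAffine.negY x y)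
    (hx : x ≠ W.toAffine.addX x x (W.toAffine.slope x x y y)) :
    (W.toAffine.addX x (W.toAffine.addX x x (W.toAffine.slope x x y y))
        (W.toAffine.slope x (W.toAffine.addX x x (W.toAffine.slope x x y y)) y
          (W.toAffine.addY x x y (W.toAffine.slope x x y y))) - x)
      * (3 * x ^ 4 + W.b₂ * x ^ 3 + 3 * W.b₄ * x ^ 2 + 3 * W.b₆ * x + W.b₈) ^ 2 =
      -(4 * x ^ 3 + W.b₂ * x ^ 2 + 2 * W.b₄ * x + W.b₆) *
        ((6 * x ^ 2 + W.b₂ * x + W.b₄) * (3 * x ^ 4 + W.b₂ * x ^ 3 + 3 * W.b₄ * x ^ 2 + 3 * W.b₆ * x + W.b₈)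
          - (4 * x ^ 3 + W.b₂ * x ^ 2 + 2 * W.b₄ * x + W.b₆) ^ 2) := by
  have heq := (Affine.equation_iff ..).mp h.left
  -- names
  obtain ⟨g, hg⟩ : ∃ g : L, g = y - W.toAffine.negY x y := ⟨_, rfl⟩
  have hgdef : g = 2 * y + W.a₁ * x + W.a₃ := by rw [hg, Affine.negY]; ring
  have hg0 : g ≠ 0 := by rw [hg]; exact sub_ne_zero.2 hy
  obtain ⟨ℓ, hℓ⟩ : ∃ ℓ : L, ℓ = W.toAffine.slope x x y y := ⟨_, rfl⟩
  have hℓg : ℓ * g = 3 * x ^ 2 + 2 * W.a₂ * x + W.a₄ - W.a₁ * y := by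
    rw [hℓ, Affine.slope_of_Y_ne rfl hy, hg]
    exact div_mul_cancel₀ _ (sub_ne_zero.2 hy)
  obtain ⟨x₂, hx₂⟩ : ∃ x₂ : L, x₂ = W.toAffine.addX x x (W.toAffine.slope x x y y) := ⟨_, rfl⟩
  obtain ⟨y₂, hy₂⟩ : ∃ y₂ : L, y₂ = W.toAffine.addY x x y (W.toAffine.slope x x y y) := ⟨_, rfl⟩
  have hx₂def : x₂ = ℓ ^ 2 + W.a₁ * ℓ - W.a₂ - x - x := by rw [hx₂, hℓ]; rfl
  have hy₂def : y₂ = -(ℓ * (x₂ - x) + y) - W.a₁ * x₂ - W.a₃ := by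
    rw [hy₂, hx₂, hℓ]; rfl
  -- the tangent step: (x2 - x) * g^2 = -Psi3(x)
  have hX2 : (x₂ - x) * g ^ 2 = -(3 * x ^ 4 + W.b₂ * x ^ 3 + 3 * W.b₄ * x ^ 2 + 3 * W.b₆ * x + W.b₈) := by
    have key := WeierstrassCurve.addX_self_sub_mul_sq (V := W) h.left hy
    rw [eval_Ψ₃_eq, ← hx₂, ← hg] at key
    exact key
  have hw0 : 3 * x ^ 4 + W.b₂ * x ^ 3 + 3 * W.b₄ * x ^ 2 + 3 * W.b₆ * x + W.b₈ ≠ 0 := by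
    intro h0
    rw [h0, neg_zero] at hX2
    rcases mul_eq_zero.1 hX2 with h1 | h1
    · exact hx (by rw [← hx₂]; linear_combination -h1)
    · exact hg0 (pow_eq_zero_iff (n := 2) (by norm_num) |>.1 h1)
  rw [← hx₂, ← hy₂]
  have hxx₂ : x - x₂ ≠ 0 := by rw [← hx₂] at hx; exact sub_ne_zero.2 hx
  -- the chord slope
  obtain ⟨m, hm⟩ : ∃ m : L, m = W.toAffine.slope x x₂ y y₂ := ⟨_, rfl⟩
  have hmdef : m * (x - x₂) = y - y₂ := by
    rw [hm, Affine.slope_of_X_ne (sub_ne_zero.1 hxx₂ |> fun h => by exact h)]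
    exact div_mul_cancel₀ _ hxx₂
  rw [← hm]
  have hx₃ : W.toAffine.addX x x₂ m = m ^ 2 + W.a₁ * m - W.a₂ - x - x₂ := rfl
  rw [hx₃]
  -- abbreviations for the polynomials
  obtain ⟨w, hw⟩ : ∃ w : L, w = 3 * x ^ 4 + W.b₂ * x ^ 3 + 3 * W.b₄ * x ^ 2 + 3 * W.b₆ * x + W.b₈ := ⟨_, rfl⟩
  rw [← hw] at hX2 hw0 ⊢
  -- (step)
  have e1 : m * w = (y - y₂) * g ^ 2 := by linear_combination g ^ 2 * hmdef + m * hX2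
  have e2 : (y - y₂) * g = g ^ 2 + (ℓ * g + W.a₁ * g) * (x₂ - x) := by rw [hy₂def, hgdef]; ring
  obtain ⟨Λ, hΛ⟩ : ∃ Λ : L, Λ = g ^ 4 - ((3 * x ^ 2 + 2 * W.a₂ * x + W.a₄ - W.a₁ * y) + W.a₁ * g) * w :=
    ⟨_, rfl⟩
  have hmΛ : m * w * g = Λ := by
    rw [hΛ, ← hℓg]
    linear_combination g * e1 + g ^ 2 * e2 + (ℓ * g + W.a₁ * g) * hX2
  have main : (m ^ 2 + W.a₁ * m - W.a₂ - x - x₂ - x) * w ^ 2 * g ^ 2 =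
      Λ ^ 2 + W.a₁ * Λ * w * g - (W.a₂ + 3 * x) * w ^ 2 * g ^ 2 + w ^ 3 := by
    linear_combination (m * w * g + Λ + W.a₁ * w * g) * hmΛ + (-(w ^ 2)) * hX2
  -- the polynomial identity (cofactor of the curve equation)
  have T : Λ ^ 2 + W.a₁ * Λ * w * g - (W.a₂ + 3 * x) * w ^ 2 * g ^ 2 + w ^ 3
      + (4 * x ^ 3 + W.b₂ * x ^ 2 + 2 * W.b₄ * x + W.b₆) *
        ((6 * x ^ 2 + W.b₂ * x + W.b₄) * w - (4 * x ^ 3 + W.b₂ * x ^ 2 + 2 * W.b₄ * x + W.b₆) ^ 2)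
        * g ^ 2 = 0 := by
    rw [hΛ, hgdef, hw]
    simp only [WeierstrassCurve.b₂, WeierstrassCurve.b₄, WeierstrassCurve.b₆, WeierstrassCurve.b₈]
    linear_combination ((7) * W.a₁ ^ 6 * x ^ 6 + (-6) * W.a₁ ^ 4 * x ^ 7 + (4) * W.a₁ ^ 4 * W.a₂ * x ^ 6 + (80) * W.a₁ ^ 5 * x ^ 5 * y + (42) * W.a₁ ^ 5 * W.a₃ * x ^ 5 + (-89) * W.a₁ ^ 2 * x ^ 8 + (-160) * W.a₁ ^ 2 * W.a₂ * x ^ 7 + (-48) * W.a₁ ^ 2 * W.a₂ ^ 2 * x ^ 6 + (112) * W.a₁ ^ 3 * x ^ 6 * y + (-54) * W.a₁ ^ 3 * W.a₃ * x ^ 6 + (128) * W.a₁ ^ 3 * W.a₂ * x ^ 5 * y + (16) * W.a₁ ^ 3 * W.a₂ * W.a₃ * x ^ 5 + (336) * W.a₁ ^ 4 * x ^ 4 * y ^ 2 + (4) * W.a₁ ^ 4 * W.a₄ * x ^ 5 + (400) * W.a₁ ^ 4 * W.a₃ * x ^ 4 * y + (105) * W.a₁ ^ 4 * W.a₃ ^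 2 * x ^ 4 + (-6) * W.a₁ ^ 4 * W.a₂ * W.a₃ ^ 2 * x ^ 3 + (6) * W.a₁ ^ 5 * W.a₃ * W.a₄ * x ^ 3 + (-6) * W.a₁ ^ 6 * W.a₆ * x ^ 3 + (-108) * x ^ 9 + (-324) * W.a₂ * x ^ 8 + (-288) * W.a₂ ^ 2 * x ^ 7 + (-64) * W.a₂ ^ 3 * x ^ 6 + (-32) * W.a₁ * x ^ 7 * y + (-232) * W.a₁ * W.a₃ * x ^ 7 + (-64) * W.a₁ * W.a₂ * x ^ 6 * y + (-392) * W.a₁ * W.a₂ * W.a₃ * x ^ 6 + (-96) * W.a₁ * W.a₂ ^ 2 * W.a₃ * x ^ 5 + (368) * W.a₁ ^ 2 * x ^ 5 * y ^ 2 + (-220) * W.a₁ ^ 2 * W.a₄ * x ^ 6 + (288) * W.a₁ ^ 2 * W.a₃ * x ^ 5 * y + (-186) * W.a₁ ^ 2 * W.a₃ ^ 2 * x ^ 5 + (384) * W.a₁ ^ 2 * W.a₂ * x ^ 4 * y ^ 2 + (-96) * W.a₁ ^ 2 * W.a₂ * W.a₄ * x ^ 5 + (384) * W.a₁ ^ 2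 * W.a₂ * W.a₃ * x ^ 4 * y + (-58) * W.a₁ ^ 2 * W.a₂ * W.a₃ ^ 2 * x ^ 4 + (-32) * W.a₁ ^ 2 * W.a₂ ^ 2 * W.a₃ ^ 2 * x ^ 3 + (768) * W.a₁ ^ 3 * x ^ 3 * y ^ 3 + (128) * W.a₁ ^ 3 * W.a₄ * x ^ 4 * y + (1344) * W.a₁ ^ 3 * W.a₃ * x ^ 3 * y ^ 2 + (98) * W.a₁ ^ 3 * W.a₃ * W.a₄ * x ^ 4 + (800) * W.a₁ ^ 3 * W.a₃ ^ 2 * x ^ 3 * y + (146) * W.a₁ ^ 3 * W.a₃ ^ 3 * x ^ 3 + (32) * W.a₁ ^ 3 * W.a₂ * W.a₃ * W.a₄ * x ^ 3 + (-16) * W.a₁ ^ 3 * W.a₂ * W.a₃ ^ 2 * x ^ 2 * y + (-18) * W.a₁ ^ 3 * W.a₂ * W.a₃ ^ 3 * x ^ 2 + (-78) * W.a₁ ^ 4 * W.a₆ * x ^ 4 + (6) * W.a₁ ^ 4 * W.a₄ ^ 2 * x ^ 3 + (16) * W.a₁ ^ 4 * W.a₃ * W.a₄ * x ^ 2 * y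 + (18) * W.a₁ ^ 4 * W.a₃ ^ 2 * W.a₄ * x ^ 2 + (-56) * W.a₁ ^ 4 * W.a₂ * W.a₆ * x ^ 3 + (-16) * W.a₁ ^ 5 * W.a₆ * x ^ 2 * y + (-18) * W.a₁ ^ 5 * W.a₃ * W.a₆ * x ^ 2 + (-32) * x ^ 6 * y ^ 2 + (-432) * W.a₄ * x ^ 7 + (-32) * W.a₃ * x ^ 6 * y + (-224) * W.a₃ ^ 2 * x ^ 6 + (-64) * W.a₂ * x ^ 5 * y ^ 2 + (-720) * W.a₂ * W.a₄ * x ^ 6 + (-64) * W.a₂ * W.a₃ * x ^ 5 * y + (-448) * W.a₂ * W.a₃ ^ 2 * x ^ 5 + (-192) * W.a₂ ^ 2 * W.a₄ * x ^ 5 + (-216) * W.a₂ ^ 2 * W.a₃ ^ 2 * x ^ 4 + (-32) * W.a₂ ^ 3 * W.a₃ ^ 2 * x ^ 3 + (512) * W.a₁ * x ^ 4 * y ^ 3 + (-160) * W.a₁ * W.a₄ * x ^ 5 * y + (688) * W.a₁ * W.a₃ * x ^ 4 * y ^ 2 + (-440) * W.a₁ * W.a₃ * W.a₄ * x ^ 5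 + (144) * W.a₁ * W.a₃ ^ 2 * x ^ 4 * y + (-252) * W.a₁ * W.a₃ ^ 3 * x ^ 4 + (512) * W.a₁ * W.a₂ * x ^ 3 * y ^ 3 + (768) * W.a₁ * W.a₂ * W.a₃ * x ^ 3 * y ^ 2 + (-24) * W.a₁ * W.a₂ * W.a₃ * W.a₄ * x ^ 4 + (224) * W.a₁ * W.a₂ * W.a₃ ^ 2 * x ^ 3 * y + (-160) * W.a₁ * W.a₂ * W.a₃ ^ 3 * x ^ 3 + (32) * W.a₁ * W.a₂ ^ 2 * W.a₃ * W.a₄ * x ^ 3 + (-64) * W.a₁ * W.a₂ ^ 2 * W.a₃ ^ 2 * x ^ 2 * y + (-56) * W.a₁ * W.a₂ ^ 2 * W.a₃ ^ 3 * x ^ 2 + (1024) * W.a₁ ^ 2 * x ^ 2 * y ^ 4 + (-592) * W.a₁ ^ 2 * W.a₆ * x ^ 5 + (384) * W.a₁ ^ 2 * W.a₄ * x ^ 3 * y ^ 2 + (34) * W.a₁ ^ 2 * W.a₄ ^ 2 * x ^ 4 + (2304) * W.a₁ ^ 2 * W.a₃ * x ^ 2 * y ^ 3 + (544) * W.a₁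 ^ 2 * W.a₃ * W.a₄ * x ^ 3 * y + (2016) * W.a₁ ^ 2 * W.a₃ ^ 2 * x ^ 2 * y ^ 2 + (220) * W.a₁ ^ 2 * W.a₃ ^ 2 * W.a₄ * x ^ 3 + (816) * W.a₁ ^ 2 * W.a₃ ^ 3 * x ^ 2 * y + (123) * W.a₁ ^ 2 * W.a₃ ^ 4 * x ^ 2 + (-592) * W.a₁ ^ 2 * W.a₂ * W.a₆ * x ^ 4 + (32) * W.a₁ ^ 2 * W.a₂ * W.a₄ ^ 2 * x ^ 3 + (64) * W.a₁ ^ 2 * W.a₂ * W.a₃ * W.a₄ * x ^ 2 * y + (-16) * W.a₁ ^ 2 * W.a₂ * W.a₃ ^ 2 * x * y ^ 2 + (36) * W.a₁ ^ 2 * W.a₂ * W.a₃ ^ 2 * W.a₄ * x ^ 2 + (-32) * W.a₁ ^ 2 * W.a₂ * W.a₃ ^ 3 * x * y + (-18) * W.a₁ ^ 2 * W.a₂ * W.a₃ ^ 4 * x + (-160) * W.a₁ ^ 2 * W.a₂ ^ 2 * W.a₆ * x ^ 3 + -(W.a₁ ^ 2 * W.a₂ ^ 2 * W.a₃ ^ 4)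 + (-32) * W.a₁ ^ 3 * W.a₆ * x ^ 3 * y + (16) * W.a₁ ^ 3 * W.a₄ ^ 2 * x ^ 2 * y + (-144) * W.a₁ ^ 3 * W.a₃ * W.a₆ * x ^ 3 + (16) * W.a₁ ^ 3 * W.a₃ * W.a₄ * x * y ^ 2 + (38) * W.a₁ ^ 3 * W.a₃ * W.a₄ ^ 2 * x ^ 2 + (32) * W.a₁ ^ 3 * W.a₃ ^ 2 * W.a₄ * x * y + (18) * W.a₁ ^ 3 * W.a₃ ^ 3 * W.a₄ * x + (-128) * W.a₁ ^ 3 * W.a₂ * W.a₆ * x ^ 2 * y + (-128) * W.a₁ ^ 3 * W.a₂ * W.a₃ * W.a₆ * x ^ 2 + (2) * W.a₁ ^ 3 * W.a₂ * W.a₃ ^ 3 * W.a₄ + (-16) * W.a₁ ^ 4 * W.a₆ * x * y ^ 2 + (-20) * W.a₁ ^ 4 * W.a₄ * W.a₆ * x ^ 2 + (-32) * W.a₁ ^ 4 * W.a₃ * W.a₆ * x * y + (-18) * W.a₁ ^ 4 * W.a₃ ^ 2 * W.a₆ * x + -(W.a₁ ^ 4 * W.a₃ ^ 2 * W.a₄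 ^ 2) + (-2) * W.a₁ ^ 4 * W.a₂ * W.a₃ ^ 2 * W.a₆ + (2) * W.a₁ ^ 5 * W.a₃ * W.a₄ * W.a₆ + -(W.a₁ ^ 6 * W.a₆ ^ 2) + (256) * x ^ 3 * y ^ 4 + (-864) * W.a₆ * x ^ 6 + (-160) * W.a₄ * x ^ 4 * y ^ 2 + (-360) * W.a₄ ^ 2 * x ^ 5 + (512) * W.a₃ * x ^ 3 * y ^ 3 + (-160) * W.a₃ * W.a₄ * x ^ 4 * y + (224) * W.a₃ ^ 2 * x ^ 3 * y ^ 2 + (-472) * W.a₃ ^ 2 * W.a₄ * x ^ 4 + (-32) * W.a₃ ^ 3 * x ^ 3 * y + (-132) * W.a₃ ^ 4 * x ^ 3 + (256) * W.a₂ * x ^ 2 * y ^ 4 + (-1728) * W.a₂ * W.a₆ * x ^ 5 + (-24) * W.a₂ * W.a₄ ^ 2 * x ^ 4 + (512) * W.a₂ * W.a₃ * x ^ 2 * y ^ 3 + (224) * W.a₂ * W.a₃ ^ 2 * x ^ 2 * y ^ 2 + (-288) * W.a₂ * W.a₃ ^ 2 * W.a₄ * x ^ 3 + (-32) * W.a₂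 * W.a₃ ^ 3 * x ^ 2 * y + (-132) * W.a₂ * W.a₃ ^ 4 * x ^ 2 + (-864) * W.a₂ ^ 2 * W.a₆ * x ^ 4 + (32) * W.a₂ ^ 2 * W.a₄ ^ 2 * x ^ 3 + (-64) * W.a₂ ^ 2 * W.a₃ ^ 2 * x * y ^ 2 + (-48) * W.a₂ ^ 2 * W.a₃ ^ 2 * W.a₄ * x ^ 2 + (-64) * W.a₂ ^ 2 * W.a₃ ^ 3 * x * y + (-52) * W.a₂ ^ 2 * W.a₃ ^ 4 * x + (-128) * W.a₂ ^ 3 * W.a₆ * x ^ 3 + (-4) * W.a₂ ^ 3 * W.a₃ ^ 4 + (768) * W.a₁ * x * y ^ 5 + (-640) * W.a₁ * W.a₆ * x ^ 4 * y + (512) * W.a₁ * W.a₄ * x ^ 2 * y ^ 3 + (160) * W.a₁ * W.a₄ ^ 2 * x ^ 3 * y + (2048) * W.a₁ * W.a₃ * x * y ^ 4 + (-1184) * W.a₁ * W.a₃ * W.a₆ * x ^ 4 + (928) * W.a₁ * W.a₃ * W.a₄ * x ^ 2 * y ^ 2 + (296) * W.a₁ * W.a₃ * W.a₄ ^ 2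 * x ^ 3 + (2304) * W.a₁ * W.a₃ ^ 2 * x * y ^ 3 + (576) * W.a₁ * W.a₃ ^ 2 * W.a₄ * x ^ 2 * y + (1360) * W.a₁ * W.a₃ ^ 3 * x * y ^ 2 + (192) * W.a₁ * W.a₃ ^ 3 * W.a₄ * x ^ 2 + (432) * W.a₁ * W.a₃ ^ 4 * x * y + (60) * W.a₁ * W.a₃ ^ 5 * x + (-640) * W.a₁ * W.a₂ * W.a₆ * x ^ 3 * y + (64) * W.a₁ * W.a₂ * W.a₄ ^ 2 * x ^ 2 * y + (-896) * W.a₁ * W.a₂ * W.a₃ * W.a₆ * x ^ 3 + (64) * W.a₁ * W.a₂ * W.a₃ * W.a₄ * x * y ^ 2 + (104) * W.a₁ * W.a₂ * W.a₃ * W.a₄ ^ 2 * x ^ 2 + (32) * W.a₁ * W.a₂ * W.a₃ ^ 2 * W.a₄ * x * y + (-16) * W.a₁ * W.a₂ * W.a₃ ^ 3 * y ^ 2 + (48) * W.a₁ * W.a₂ * W.a₃ ^ 3 * W.a₄ * x + (-16) * W.a₁ * W.a₂ * W.a₃ ^ 4 * y + (-4) * W.a₁ * W.a₂ * W.a₃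 ^ 5 + (-256) * W.a₁ * W.a₂ ^ 2 * W.a₆ * x ^ 2 * y + (-224) * W.a₁ * W.a₂ ^ 2 * W.a₃ * W.a₆ * x ^ 2 + (8) * W.a₁ * W.a₂ ^ 2 * W.a₃ ^ 3 * W.a₄ + (224) * W.a₁ ^ 2 * W.a₆ * x ^ 2 * y ^ 2 + (-256) * W.a₁ ^ 2 * W.a₄ * W.a₆ * x ^ 3 + (16) * W.a₁ ^ 2 * W.a₄ ^ 2 * x * y ^ 2 + (20) * W.a₁ ^ 2 * W.a₄ ^ 3 * x ^ 2 + (288) * W.a₁ ^ 2 * W.a₃ * W.a₆ * x ^ 2 * y + (64) * W.a₁ ^ 2 * W.a₃ * W.a₄ ^ 2 * x * y + (-24) * W.a₁ ^ 2 * W.a₃ ^ 2 * W.a₆ * x ^ 2 + (16) * W.a₁ ^ 2 * W.a₃ ^ 2 * W.a₄ * y ^ 2 + (22) * W.a₁ ^ 2 * W.a₃ ^ 2 * W.a₄ ^ 2 * x + (16) * W.a₁ ^ 2 * W.a₃ ^ 3 * W.a₄ * y + (4) * W.a₁ ^ 2 * W.a₃ ^ 4 * W.a₄ + (-128) * W.a₁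 ^ 2 * W.a₂ * W.a₆ * x * y ^ 2 + (-128) * W.a₁ ^ 2 * W.a₂ * W.a₄ * W.a₆ * x ^ 2 + (-192) * W.a₁ ^ 2 * W.a₂ * W.a₃ * W.a₆ * x * y + (-160) * W.a₁ ^ 2 * W.a₂ * W.a₃ ^ 2 * W.a₆ * x + (-2) * W.a₁ ^ 2 * W.a₂ * W.a₃ ^ 2 * W.a₄ ^ 2 + (-16) * W.a₁ ^ 2 * W.a₂ ^ 2 * W.a₃ ^ 2 * W.a₆ + (-32) * W.a₁ ^ 3 * W.a₄ * W.a₆ * x * y + (-16) * W.a₁ ^ 3 * W.a₃ * W.a₆ * y ^ 2 + (32) * W.a₁ ^ 3 * W.a₃ * W.a₄ * W.a₆ * x + (-2) * W.a₁ ^ 3 * W.a₃ * W.a₄ ^ 3 + (-16) * W.a₁ ^ 3 * W.a₃ ^ 2 * W.a₆ * y + (-4) * W.a₁ ^ 3 * W.a₃ ^ 3 * W.a₆ + (16) * W.a₁ ^ 3 * W.a₂ * W.a₃ * W.a₄ * W.a₆ + (-36) * W.a₁ ^ 4 * W.a₆ ^ 2 * x + (2) * W.a₁ ^ 4 * W.a₄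 ^ 2 * W.a₆ + (-12) * W.a₁ ^ 4 * W.a₂ * W.a₆ ^ 2 + (256) * y ^ 6 + (-640) * W.a₆ * x ^ 3 * y ^ 2 + (256) * W.a₄ * x * y ^ 4 + (-1728) * W.a₄ * W.a₆ * x ^ 4 + (160) * W.a₄ ^ 2 * x ^ 2 * y ^ 2 + (144) * W.a₄ ^ 3 * x ^ 3 + (768) * W.a₃ * y ^ 5 + (-640) * W.a₃ * W.a₆ * x ^ 3 * y + (512) * W.a₃ * W.a₄ * x * y ^ 3 + (160) * W.a₃ * W.a₄ ^ 2 * x ^ 2 * y + (1024) * W.a₃ ^ 2 * y ^ 4 + (-1024) * W.a₃ ^ 2 * W.a₆ * x ^ 3 + (416) * W.a₃ ^ 2 * W.a₄ * x * y ^ 2 + (112) * W.a₃ ^ 2 * W.a₄ ^ 2 * x ^ 2 + (768) * W.a₃ ^ 3 * y ^ 3 + (160) * W.a₃ ^ 3 * W.a₄ * x * y + (352) * W.a₃ ^ 4 * y ^ 2 + (24) * W.a₃ ^ 4 * W.a₄ * x + (96) * W.a₃ ^ 5 * y + (12) * W.a₃ ^ 6 + (-640) * W.a₂ * W.a₆ *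 x ^ 2 * y ^ 2 + (-1152) * W.a₂ * W.a₄ * W.a₆ * x ^ 3 + (64) * W.a₂ * W.a₄ ^ 2 * x * y ^ 2 + (48) * W.a₂ * W.a₄ ^ 3 * x ^ 2 + (-640) * W.a₂ * W.a₃ * W.a₆ * x ^ 2 * y + (64) * W.a₂ * W.a₃ * W.a₄ ^ 2 * x * y + (-1024) * W.a₂ * W.a₃ ^ 2 * W.a₆ * x ^ 2 + (-32) * W.a₂ * W.a₃ ^ 2 * W.a₄ * y ^ 2 + (64) * W.a₂ * W.a₃ ^ 2 * W.a₄ ^ 2 * x + (-32) * W.a₂ * W.a₃ ^ 3 * W.a₄ * y + (-8) * W.a₂ * W.a₃ ^ 4 * W.a₄ + (-256) * W.a₂ ^ 2 * W.a₆ * x * y ^ 2 + (-192) * W.a₂ ^ 2 * W.a₄ * W.a₆ * x ^ 2 + (-256) * W.a₂ ^ 2 * W.a₃ * W.a₆ * x * y + (-352) * W.a₂ ^ 2 * W.a₃ ^ 2 * W.a₆ * x + (8) * W.a₂ ^ 2 * W.a₃ ^ 2 * W.a₄ ^ 2 + (-32) * W.a₂ ^ 3 * W.a₃ ^ 2 *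 W.a₆ + (512) * W.a₁ * W.a₆ * x * y ^ 3 + (128) * W.a₁ * W.a₄ * W.a₆ * x ^ 2 * y + (32) * W.a₁ * W.a₄ ^ 3 * x * y + (832) * W.a₁ * W.a₃ * W.a₆ * x * y ^ 2 + (352) * W.a₁ * W.a₃ * W.a₄ * W.a₆ * x ^ 2 + (48) * W.a₁ * W.a₃ * W.a₄ ^ 2 * y ^ 2 + (-8) * W.a₁ * W.a₃ * W.a₄ ^ 3 * x + (576) * W.a₁ * W.a₃ ^ 2 * W.a₆ * x * y + (48) * W.a₁ * W.a₃ ^ 2 * W.a₄ ^ 2 * y + (144) * W.a₁ * W.a₃ ^ 3 * W.a₆ * x + (12) * W.a₁ * W.a₃ ^ 3 * W.a₄ ^ 2 + (-128) * W.a₁ * W.a₂ * W.a₄ * W.a₆ * x * y + (-64) * W.a₁ * W.a₂ * W.a₃ * W.a₆ * y ^ 2 + (128) * W.a₁ * W.a₂ * W.a₃ * W.a₄ * W.a₆ * x + (-8) * W.a₁ * W.a₂ * W.a₃ * W.a₄ ^ 3 + (-64) * W.a₁ * W.a₂ * W.a₃ ^ 2 * W.a₆ * y + (-16) * W.a₁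 * W.a₂ * W.a₃ ^ 3 * W.a₆ + (32) * W.a₁ * W.a₂ ^ 2 * W.a₃ * W.a₄ * W.a₆ + (-368) * W.a₁ ^ 2 * W.a₆ ^ 2 * x ^ 2 + (-32) * W.a₁ ^ 2 * W.a₄ * W.a₆ * y ^ 2 + (48) * W.a₁ ^ 2 * W.a₄ ^ 2 * W.a₆ * x + -(W.a₁ ^ 2 * W.a₄ ^ 4) + (-32) * W.a₁ ^ 2 * W.a₃ * W.a₄ * W.a₆ * y + (-8) * W.a₁ ^ 2 * W.a₃ ^ 2 * W.a₄ * W.a₆ + (-288) * W.a₁ ^ 2 * W.a₂ * W.a₆ ^ 2 * x + (16) * W.a₁ ^ 2 * W.a₂ * W.a₄ ^ 2 * W.a₆ + (-48) * W.a₁ ^ 2 * W.a₂ ^ 2 * W.a₆ ^ 2 + (256) * W.a₆ * y ^ 4 + (-1728) * W.a₆ ^ 2 * x ^ 3 + (128) * W.a₄ * W.a₆ * x * y ^ 2 + (288) * W.a₄ ^ 2 * W.a₆ * x ^ 2 + (32) * W.a₄ ^ 3 * y ^ 2 + (-12) * W.a₄ ^ 4 * x + (512) * W.a₃ * W.a₆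 * y ^ 3 + (128) * W.a₃ * W.a₄ * W.a₆ * x * y + (32) * W.a₃ * W.a₄ ^ 3 * y + (512) * W.a₃ ^ 2 * W.a₆ * y ^ 2 + (32) * W.a₃ ^ 2 * W.a₄ * W.a₆ * x + (8) * W.a₃ ^ 2 * W.a₄ ^ 3 + (256) * W.a₃ ^ 3 * W.a₆ * y + (48) * W.a₃ ^ 4 * W.a₆ + (-1728) * W.a₂ * W.a₆ ^ 2 * x ^ 2 + (-128) * W.a₂ * W.a₄ * W.a₆ * y ^ 2 + (192) * W.a₂ * W.a₄ ^ 2 * W.a₆ * x + (-4) * W.a₂ * W.a₄ ^ 4 + (-128) * W.a₂ * W.a₃ * W.a₄ * W.a₆ * y + (-32) * W.a₂ * W.a₃ ^ 2 * W.a₄ * W.a₆ + (-576) * W.a₂ ^ 2 * W.a₆ ^ 2 * x + (32) * W.a₂ ^ 2 * W.a₄ ^ 2 * W.a₆ + (-64) * W.a₂ ^ 3 * W.a₆ ^ 2 + (256) * W.a₁ * W.a₆ ^ 2 * x * y + (128) * W.a₁ * W.a₃ * W.a₆ ^ 2 * x + (256) * W.a₆ ^ 2 * y ^ 2 + (256)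 * W.a₃ * W.a₆ ^ 2 * y + (64) * W.a₃ ^ 2 * W.a₆ ^ 2) * heq
  have hg2 : g ^ 2 ≠ 0 := pow_ne_zero 2 hg0
  apply mul_right_cancel₀ hg2
  rw [hw]
  rw [hw] at main T
  linear_combination main + T


/-- **Relations at a point of order `7`.**  For an affine point `P = (x, y)` with `7P = O` on a
Weierstrass curve over a field: `P` is not `2`-torsion, and with `υ = ψ₂²(x)`, `w = Ψ₃(x)`,
`P₄ = τw − υ²`: `υ ≠ 0`, `w ≠ 0`, `P₄ ≠ 0` and the `7`-division relation
`R₇ := w⁶ − w³P₄υ² + P₄³υ² = 0` (`= −Ψ₇(x)`).  Proof: `4P = −3P`; `x(4P)` by two doublings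
(`addX_self_mul_upsilon`, `upsilon_double`, `Ψ₃_double`), `x(3P)` by `addX_chord_three`.
[cite: SilvermanAEC2009, III.§2, Ex. 3.7] -/
theorem order_seven_relations {L : Type*} [Field L] (W : WeierstrassCurve L) {x₁ y₁ : L}
    (h₁ : W.toAffine.Nonsingular x₁ y₁)
    (h7 : (7 : ℕ) • (Affine.Point.some x₁ y₁ h₁ : W.toAffine.Point) = 0) :
    y₁ ≠ W.toAffine.negY x₁ y₁ ∧
    4 * x₁ ^ 3 + W.b₂ * x₁ ^ 2 + 2 * W.b₄ * x₁ + W.b₆ ≠ 0 ∧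
    3 * x₁ ^ 4 + W.b₂ * x₁ ^ 3 + 3 * W.b₄ * x₁ ^ 2 + 3 * W.b₆ * x₁ + W.b₈ ≠ 0 ∧
    (6 * x₁ ^ 2 + W.b₂ * x₁ + W.b₄) * (3 * x₁ ^ 4 + W.b₂ * x₁ ^ 3 + 3 * W.b₄ * x₁ ^ 2 + 3 * W.b₆ * x₁ + W.b₈)
        - (4 * x₁ ^ 3 + W.b₂ * x₁ ^ 2 + 2 * W.b₄ * x₁ + W.b₆) ^ 2 ≠ 0 ∧
    (3 * x₁ ^ 4 + W.b₂ * x₁ ^ 3 + 3 * W.b₄ * x₁ ^ 2 + 3 * W.b₆ * x₁ + W.b₈) ^ 6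
      - (3 * x₁ ^ 4 + W.b₂ * x₁ ^ 3 + 3 * W.b₄ * x₁ ^ 2 + 3 * W.b₆ * x₁ + W.b₈) ^ 3
        * ((6 * x₁ ^ 2 + W.b₂ * x₁ + W.b₄)
            * (3 * x₁ ^ 4 + W.b₂ * x₁ ^ 3 + 3 * W.b₄ * x₁ ^ 2 + 3 * W.b₆ * x₁ + W.b₈)
          - (4 * x₁ ^ 3 + W.b₂ * x₁ ^ 2 + 2 * W.b₄ * x₁ + W.b₆) ^ 2)
        * (4 * x₁ ^ 3 + W.b₂ * x₁ ^ 2 + 2 * W.b₄ * x₁ + W.b₆) ^ 2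
      + ((6 * x₁ ^ 2 + W.b₂ * x₁ + W.b₄)
            * (3 * x₁ ^ 4 + W.b₂ * x₁ ^ 3 + 3 * W.b₄ * x₁ ^ 2 + 3 * W.b₆ * x₁ + W.b₈)
          - (4 * x₁ ^ 3 + W.b₂ * x₁ ^ 2 + 2 * W.b₄ * x₁ + W.b₆) ^ 2) ^ 3
        * (4 * x₁ ^ 3 + W.b₂ * x₁ ^ 2 + 2 * W.b₄ * x₁ + W.b₆) ^ 2 = 0 := by
  set Q : W.toAffine.Point := Affine.Point.some x₁ y₁ h₁ with hQ
  have hQ0 : Q ≠ 0 := by rw [hQ]; exact fun h => by cases h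
  -- `P` is not `2`-torsion
  have hy₁ : y₁ ≠ W.toAffine.negY x₁ y₁ := by
    intro hy
    have h2 : Q + Q = 0 := Affine.Point.add_self_of_Y_eq hy
    apply hQ0
    have : Q = 7 • Q - 3 • (Q + Q) := by abel
    rw [this, h7, h2, nsmul_zero, sub_zero]
  -- `2P = (x₂, y₂)`
  have h2Q := Affine.Point.add_self_of_Y_ne (h₁ := h₁) hy₁
  obtain ⟨x₂, hx₂⟩ : ∃ x₂ : L, x₂ = W.toAffine.addX x₁ x₁ (W.toAffine.slope x₁ x₁ y₁ y₁) := ⟨_, rfl⟩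
  obtain ⟨y₂, hy₂d⟩ : ∃ y₂ : L, y₂ = W.toAffine.addY x₁ x₁ y₁ (W.toAffine.slope x₁ x₁ y₁ y₁) := ⟨_, rfl⟩
  have h₂ : W.toAffine.Nonsingular x₂ y₂ := by
    rw [hx₂, hy₂d]; exact Affine.nonsingular_add h₁ h₁ fun hxy => hy₁ hxy.right
  have h2Q' : Q + Q = Affine.Point.some x₂ y₂ h₂ := by
    rw [hQ, h2Q]; simp only [hx₂, hy₂d]
  -- `2P` is not `2`-torsion
  have hy₂ : y₂ ≠ W.toAffine.negY x₂ y₂ := by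
    intro hy
    have h4 : (Affine.Point.some x₂ y₂ h₂ : W.toAffine.Point) + Affine.Point.some x₂ y₂ h₂ = 0 :=
      Affine.Point.add_self_of_Y_eq hy
    apply hQ0
    have : Q = 2 • ((Q + Q) + (Q + Q)) - 7 • Q := by abel
    rw [this, h7, h2Q', h4, nsmul_zero, zero_sub, neg_zero]
  -- `x₁ ≠ x₂` (else `2P = ±P`)
  have hx12 : x₁ ≠ x₂ := by
    intro hx
    have hy : y₂ = y₁ ∨ y₂ = W.toAffine.negY x₁ y₁ := by
      by_cases hy' : y₂ = W.toAffine.negY x₁ y₁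
      · exact Or.inr hy'
      · exact Or.inl (Affine.Y_eq_of_Y_ne h₂.left h₁.left hx.symm hy')
    rcases hy with hy | hy
    · -- `2P = P`
      apply hQ0
      have e : Q + Q = Q := by
        rw [h2Q', hQ]; simp only [Affine.Point.some.injEq]; exact ⟨hx.symm, hy⟩
      have : Q = (Q + Q) - Q := by abel
      rw [this, e, sub_self]
    · -- `2P = -P`, so `3P = 0`
      apply hQ0
      have e : Q + Q = -Q := by
        rw [h2Q', hQ, Affine.Point.neg_some]; simp only [Affine.Point.some.injEq]; exact ⟨hx.symm, hy⟩
      have e3 : 3 • Q = 0 := by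
        have : 3 • Q = (Q + Q) + Q := by abel
        rw [this, e, neg_add_cancel]
      have : Q = 7 • Q - 2 • (3 • Q) := by abel
      rw [this, h7, e3, nsmul_zero, sub_zero]
  -- `3P = P + 2P = (x₃, y₃)` and `4P = 2P + 2P`
  have hx12' : x₁ ≠ W.toAffine.addX x₁ x₁ (W.toAffine.slope x₁ x₁ y₁ y₁) := by rw [← hx₂]; exact hx12
  have h3Q : Q + Affine.Point.some x₂ y₂ h₂ = Affine.Point.some _ _
      (Affine.nonsingular_add h₁ h₂ fun hxy => hx12 hxy.left) := by
    rw [hQ]; exact Affine.Point.add_of_X_ne hx12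
  have h4Q := Affine.Point.add_self_of_Y_ne (h₁ := h₂) hy₂
  have h43 : (Affine.Point.some x₂ y₂ h₂ : W.toAffine.Point) + Affine.Point.some x₂ y₂ h₂ =
      -(Q + Affine.Point.some x₂ y₂ h₂) := by
    rw [← h2Q', eq_neg_iff_add_eq_zero, ← h7]
    abel
  have hx43 : W.toAffine.addX x₂ x₂ (W.toAffine.slope x₂ x₂ y₂ y₂) =
      W.toAffine.addX x₁ x₂ (W.toAffine.slope x₁ x₂ y₁ y₂) := by
    rw [h4Q, h3Q, Affine.Point.neg_some] at h43
    exact (Affine.Point.some.inj h43).1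
  -- atoms at `x₁`
  obtain ⟨τ, hτ⟩ : ∃ τ : L, τ = 6 * x₁ ^ 2 + W.b₂ * x₁ + W.b₄ := ⟨_, rfl⟩
  obtain ⟨υ, hυd⟩ : ∃ υ : L, υ = 4 * x₁ ^ 3 + W.b₂ * x₁ ^ 2 + 2 * W.b₄ * x₁ + W.b₆ := ⟨_, rfl⟩
  obtain ⟨w, hwd⟩ : ∃ w : L, w = 3 * x₁ ^ 4 + W.b₂ * x₁ ^ 3 + 3 * W.b₄ * x₁ ^ 2 + 3 * W.b₆ * x₁ + W.b₈ :=
    ⟨_, rfl⟩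
  have hυ0 : υ ≠ 0 := by
    rw [hυd, ← sq_sub_negY_eq_upsilon W h₁.left]; exact pow_ne_zero 2 (sub_ne_zero.2 hy₁)
  -- the group-law relations
  have e_b : x₂ * υ = x₁ * υ - w := by
    rw [hx₂, hυd, hwd]; exact addX_self_mul_upsilon W h₁.left hy₁
  have hw0 : w ≠ 0 := by
    intro h0; apply hx12
    rw [h0, sub_zero] at e_b
    exact (mul_right_cancel₀ hυ0 e_b).symm
  have e_a := addX_chord_three W h₁ hy₁ hx12'
  rw [← hx₂, ← hy₂d, ← hτ, ← hυd, ← hwd] at e_a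
  have e_c := addX_self_mul_upsilon W h₂.left hy₂
  rw [hx43] at e_c
  have hυ₂0 : 4 * x₂ ^ 3 + W.b₂ * x₂ ^ 2 + 2 * W.b₄ * x₂ + W.b₆ ≠ 0 := by
    rw [← sq_sub_negY_eq_upsilon W h₂.left]; exact pow_ne_zero 2 (sub_ne_zero.2 hy₂)
  have e_d : (4 * x₂ ^ 3 + W.b₂ * x₂ ^ 2 + 2 * W.b₄ * x₂ + W.b₆) * υ ^ 3 = (τ * w - υ ^ 2) ^ 2 := by
    have u3 := upsilon_double W x₁
    rw [← hτ, ← hυd, ← hwd, ← e_b] at u3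
    linear_combination u3
  have e_e : (3 * x₂ ^ 4 + W.b₂ * x₂ ^ 3 + 3 * W.b₄ * x₂ ^ 2 + 3 * W.b₆ * x₂ + W.b₈) * υ ^ 4 =
      w * ((τ * w - υ ^ 2) * υ ^ 2 - w ^ 3 - (τ * w - υ ^ 2) ^ 2) := by
    have u4 := Ψ₃_double W x₁
    rw [← hτ, ← hυd, ← hwd, ← e_b] at u4
    linear_combination u4
  have hP40 : τ * w - υ ^ 2 ≠ 0 := by
    intro h0
    rw [h0] at e_d
    have : (4 * x₂ ^ 3 + W.b₂ * x₂ ^ 2 + 2 * W.b₄ * x₂ + W.b₆) * υ ^ 3 = 0 := by rw [e_d]; ring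
    rcases mul_eq_zero.1 this with h | h
    · exact hυ₂0 h
    · exact pow_ne_zero 3 hυ0 h
  rw [← hτ, ← hυd, ← hwd]
  refine ⟨hy₁, hυ0, hw0, hP40, ?_⟩
  -- combine: `x(4P) = x(3P)`
  obtain ⟨x₃, hx₃⟩ : ∃ x₃ : L, x₃ = W.toAffine.addX x₁ x₂ (W.toAffine.slope x₁ x₂ y₁ y₂) := ⟨_, rfl⟩
  rw [← hx₃] at e_a e_c
  obtain ⟨υ₂, hυ₂⟩ : ∃ υ₂ : L, υ₂ = 4 * x₂ ^ 3 + W.b₂ * x₂ ^ 2 + 2 * W.b₄ * x₂ + W.b₆ := ⟨_, rfl⟩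
  obtain ⟨w₂, hw₂⟩ : ∃ w₂ : L, w₂ = 3 * x₂ ^ 4 + W.b₂ * x₂ ^ 3 + 3 * W.b₄ * x₂ ^ 2 + 3 * W.b₆ * x₂ + W.b₈ :=
    ⟨_, rfl⟩
  rw [← hυ₂, ← hw₂] at e_c
  rw [← hυ₂] at e_d
  rw [← hw₂] at e_e
  have s1 : (x₃ - x₂) * w ^ 2 * υ = w ^ 3 - υ ^ 2 * (τ * w - υ ^ 2) := by
    linear_combination υ * e_a - w ^ 2 * e_b
  have s2 : ((x₃ - x₂) * υ₂ + w₂) * (w ^ 2 * υ ^ 4) =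
      -(w ^ 6 - w ^ 3 * (τ * w - υ ^ 2) * υ ^ 2 + (τ * w - υ ^ 2) ^ 3 * υ ^ 2) := by
    linear_combination (υ₂ * υ ^ 3) * s1 + (w ^ 3 - υ ^ 2 * (τ * w - υ ^ 2)) * e_d + w ^ 2 * e_e
  have e_c' : (x₃ - x₂) * υ₂ + w₂ = 0 := by linear_combination e_c
  rw [e_c', zero_mul] at s2
  linear_combination s2

/-- Passing to the hauptmodul `u = Un/Ud` for the `X₀(7)` shape (`Ud ≠ 0`). [folklore] -/
theorem X0_seven_hauptmodul_div {L : Type*} [Field L] {c Δ Un Ud : L} (hUd : Ud ≠ 0)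
    (h : c * Un * Ud ^ 7 = (Un ^ 2 + 13 * Un * Ud + 49 * Ud ^ 2) * (Un ^ 2 + 5 * Un * Ud + Ud ^ 2) ^ 3 * Δ) :
    c * (Un / Ud) = ((Un / Ud) ^ 2 + 13 * (Un / Ud) + 49) * ((Un / Ud) ^ 2 + 5 * (Un / Ud) + 1) ^ 3 * Δ := by
  set u := Un / Ud with hu
  have hu' : Un = u * Ud := by rw [hu, div_mul_cancel₀ _ hUd]
  have key : Ud ^ 8 * (c * u - (u ^ 2 + 13 * u + 49) * (u ^ 2 + 5 * u + 1) ^ 3 * Δ) = 0 := by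
    rw [hu'] at h
    linear_combination h
  have := (mul_eq_zero.1 key).resolve_left (pow_ne_zero 8 hUd)
  linear_combination this

/-- **The `X₀(7)` hauptmodul at an order-`7` relation.**  Over a field, let `x` satisfy `υ(x) ≠ 0`,
`w = Ψ₃(x) ≠ 0`, `P₄(x) ≠ 0` and `R₇(x) = 0` (e.g. `x = x(P)`, `7P = O`, by `order_seven_relations`).
With the Tate coordinate `d := w³/(P₄υ²)` (`= b/c`, the `X₁(7)`-parameter) one has `P₄ = υ²(d − d²)`,
`w³ = υ⁴d²(1−d)`, `c₄·w⁴ = υ⁶·(d²−d+1)(d⁶−11d⁵+30d⁴−15d³−10d²+5d+1)`,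
`Δ·w¹² = υ¹⁸·d⁷(d−1)⁷(d³−8d²+5d+1)`, and `u := (d³ − 8d² + 5d + 1)/(d(d−1))` satisfies
`c₄³·u = (u² + 13u + 49)(u² + 5u + 1)³·Δ` — `j = (u²+13u+49)(u²+5u+1)³/u`, Klein's `X₀(7) → X(1)`.
[cite: SilvermanAEC2009, III.§1, Ex. 3.7] -/
theorem exists_X0_seven_hauptmodul_of_relation {L : Type*} [Field L] (W : WeierstrassCurve L) {x d : L}
    (hυ : 4 * x ^ 3 + W.b₂ * x ^ 2 + 2 * W.b₄ * x + W.b₆ ≠ 0)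
    (hw : 3 * x ^ 4 + W.b₂ * x ^ 3 + 3 * W.b₄ * x ^ 2 + 3 * W.b₆ * x + W.b₈ ≠ 0)
    (hP4 : (6 * x ^ 2 + W.b₂ * x + W.b₄) * (3 * x ^ 4 + W.b₂ * x ^ 3 + 3 * W.b₄ * x ^ 2 + 3 * W.b₆ * x + W.b₈)
        - (4 * x ^ 3 + W.b₂ * x ^ 2 + 2 * W.b₄ * x + W.b₆) ^ 2 ≠ 0)
    (hR7 : (3 * x ^ 4 + W.b₂ * x ^ 3 + 3 * W.b₄ * x ^ 2 + 3 * W.b₆ * x + W.b₈) ^ 6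
      - (3 * x ^ 4 + W.b₂ * x ^ 3 + 3 * W.b₄ * x ^ 2 + 3 * W.b₆ * x + W.b₈) ^ 3
        * ((6 * x ^ 2 + W.b₂ * x + W.b₄)
            * (3 * x ^ 4 + W.b₂ * x ^ 3 + 3 * W.b₄ * x ^ 2 + 3 * W.b₆ * x + W.b₈)
          - (4 * x ^ 3 + W.b₂ * x ^ 2 + 2 * W.b₄ * x + W.b₆) ^ 2)
        * (4 * x ^ 3 + W.b₂ * x ^ 2 + 2 * W.b₄ * x + W.b₆) ^ 2
      + ((6 * x ^ 2 + W.b₂ * x + W.b₄)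
            * (3 * x ^ 4 + W.b₂ * x ^ 3 + 3 * W.b₄ * x ^ 2 + 3 * W.b₆ * x + W.b₈)
          - (4 * x ^ 3 + W.b₂ * x ^ 2 + 2 * W.b₄ * x + W.b₆) ^ 2) ^ 3
        * (4 * x ^ 3 + W.b₂ * x ^ 2 + 2 * W.b₄ * x + W.b₆) ^ 2 = 0)
    (hd : d * (((6 * x ^ 2 + W.b₂ * x + W.b₄)
          * (3 * x ^ 4 + W.b₂ * x ^ 3 + 3 * W.b₄ * x ^ 2 + 3 * W.b₆ * x + W.b₈)
        - (4 * x ^ 3 + W.b₂ * x ^ 2 + 2 * W.b₄ * x + W.b₆) ^ 2)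
        * (4 * x ^ 3 + W.b₂ * x ^ 2 + 2 * W.b₄ * x + W.b₆) ^ 2) =
      (3 * x ^ 4 + W.b₂ * x ^ 3 + 3 * W.b₄ * x ^ 2 + 3 * W.b₆ * x + W.b₈) ^ 3) :
    d ≠ 0 ∧ d ≠ 1 ∧
      W.c₄ ^ 3 * ((d ^ 3 - 8 * d ^ 2 + 5 * d + 1) / (d * (d - 1))) =
        (((d ^ 3 - 8 * d ^ 2 + 5 * d + 1) / (d * (d - 1))) ^ 2
            + 13 * ((d ^ 3 - 8 * d ^ 2 + 5 * d + 1) / (d * (d - 1))) + 49)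
          * (((d ^ 3 - 8 * d ^ 2 + 5 * d + 1) / (d * (d - 1))) ^ 2
            + 5 * ((d ^ 3 - 8 * d ^ 2 + 5 * d + 1) / (d * (d - 1))) + 1) ^ 3 * W.Δ := by
  -- atoms
  obtain ⟨τ, hτ⟩ : ∃ τ : L, τ = 6 * x ^ 2 + W.b₂ * x + W.b₄ := ⟨_, rfl⟩
  obtain ⟨υ, hυd⟩ : ∃ υ : L, υ = 4 * x ^ 3 + W.b₂ * x ^ 2 + 2 * W.b₄ * x + W.b₆ := ⟨_, rfl⟩
  obtain ⟨w, hwd⟩ : ∃ w : L, w = 3 * x ^ 4 + W.b₂ * x ^ 3 + 3 * W.b₄ * x ^ 2 + 3 * W.b₆ * x + W.b₈ :=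
    ⟨_, rfl⟩
  have hC := c₄_mul_upsilon_sq W x
  have hD := Δ_mul_upsilon_sq W x
  rw [← hτ] at hC hD hP4 hR7 hd
  rw [← hυd] at hC hD hυ hP4 hR7 hd
  rw [← hwd] at hC hD hw hP4 hR7 hd
  have hdmul : d * ((τ * w - υ ^ 2) * υ ^ 2) = w ^ 3 := hd
  -- `P₄ = υ²(d − d²)` from `R₇`
  have hRa : τ * w - υ ^ 2 = υ ^ 2 * (d - d ^ 2) := by
    have key : ((τ * w - υ ^ 2) * υ) ^ 2 * ((τ * w - υ ^ 2) - υ ^ 2 * (d - d ^ 2)) = 0 := by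
      have hw3 : w ^ 3 = d * ((τ * w - υ ^ 2) * υ ^ 2) := hdmul.symm
      linear_combination hR7
        + ((τ * w - υ ^ 2) * υ ^ 2 - d * ((τ * w - υ ^ 2) * υ ^ 2) - w ^ 3) * hw3
    have hne : ((τ * w - υ ^ 2) * υ) ^ 2 ≠ 0 := pow_ne_zero 2 (mul_ne_zero hP4 hυ)
    exact sub_eq_zero.1 ((mul_eq_zero.1 key).resolve_left hne)
  have hRb : w ^ 3 = d * (υ ^ 2 * (d - d ^ 2)) * υ ^ 2 := by rw [← hdmul, hRa]; ring
  have hτw : τ * w = υ ^ 2 * (d - d ^ 2) + υ ^ 2 := by linear_combination hRa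
  have hd0 : d ≠ 0 := by
    intro h0; apply hw
    have : w ^ 3 = 0 := by rw [hRb, h0]; ring
    exact pow_eq_zero_iff (n := 3) (by norm_num) |>.1 this
  have hd1 : d ≠ 1 := by
    intro h1; apply hP4; rw [hRa, h1]; ring
  -- `c₄ w⁴ = υ⁶ c₄ᵀ(d)`, `Δ w¹² = υ¹⁸ Δᵀ(d)`
  have E1 : W.c₄ * υ ^ 2 * w ^ 4 = ((τ * w) ^ 2 + 4 * w ^ 3) ^ 2 - 24 * (τ * w) * υ ^ 2 * w ^ 3 := by
    linear_combination w ^ 4 * hC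
  rw [hτw, hRb] at E1
  have hc4 : W.c₄ * w ^ 4 =
      υ ^ 6 * ((d ^ 2 - d + 1) * (d ^ 6 - 11 * d ^ 5 + 30 * d ^ 4 - 15 * d ^ 3 - 10 * d ^ 2 + 5 * d + 1)) := by
    apply mul_left_cancel₀ (pow_ne_zero 2 hυ)
    linear_combination E1
  have E2 : W.Δ * υ ^ 2 * w ^ 12 = -((τ * w) ^ 2 + 4 * w ^ 3) ^ 2 * (w ^ 3) ^ 3
      - 8 * (τ * w) ^ 3 * υ ^ 2 * (w ^ 3) ^ 3 - 27 * υ ^ 4 * (w ^ 3) ^ 4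
      + 9 * (τ * w) * ((τ * w) ^ 2 + 4 * w ^ 3) * υ ^ 2 * (w ^ 3) ^ 3 := by
    linear_combination w ^ 12 * hD
  rw [hτw, hRb] at E2
  have hΔ : W.Δ * w ^ 12 = υ ^ 18 * (d ^ 7 * (d - 1) ^ 7 * (d ^ 3 - 8 * d ^ 2 + 5 * d + 1)) := by
    apply mul_left_cancel₀ (pow_ne_zero 2 hυ)
    linear_combination E2
  -- the univariate hauptmodul identity
  have poly : ((d ^ 2 - d + 1) * (d ^ 6 - 11 * d ^ 5 + 30 * d ^ 4 - 15 * d ^ 3 - 10 * d ^ 2 + 5 * d + 1)) ^ 3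
      * (d ^ 3 - 8 * d ^ 2 + 5 * d + 1) * (d * (d - 1)) ^ 7 =
      ((d ^ 3 - 8 * d ^ 2 + 5 * d + 1) ^ 2 + 13 * (d ^ 3 - 8 * d ^ 2 + 5 * d + 1) * (d * (d - 1))
          + 49 * (d * (d - 1)) ^ 2)
        * ((d ^ 3 - 8 * d ^ 2 + 5 * d + 1) ^ 2 + 5 * (d ^ 3 - 8 * d ^ 2 + 5 * d + 1) * (d * (d - 1))
          + (d * (d - 1)) ^ 2) ^ 3
        * (d ^ 7 * (d - 1) ^ 7 * (d ^ 3 - 8 * d ^ 2 + 5 * d + 1)) := by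
    ring
  have hUd : d * (d - 1) ≠ 0 := mul_ne_zero hd0 (sub_ne_zero.2 hd1)
  have hu := X0_seven_hauptmodul_div
    (c := ((d ^ 2 - d + 1) * (d ^ 6 - 11 * d ^ 5 + 30 * d ^ 4 - 15 * d ^ 3 - 10 * d ^ 2 + 5 * d + 1)) ^ 3)
    (Δ := d ^ 7 * (d - 1) ^ 7 * (d ^ 3 - 8 * d ^ 2 + 5 * d + 1)) hUd poly
  refine ⟨hd0, hd1, ?_⟩
  set u := (d ^ 3 - 8 * d ^ 2 + 5 * d + 1) / (d * (d - 1)) with hudef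
  have A3 : (W.c₄ * w ^ 4) ^ 3 =
      (υ ^ 6 * ((d ^ 2 - d + 1) * (d ^ 6 - 11 * d ^ 5 + 30 * d ^ 4 - 15 * d ^ 3 - 10 * d ^ 2 + 5 * d + 1))) ^ 3 := by
    rw [hc4]
  have key : w ^ 12 * (W.c₄ ^ 3 * u - (u ^ 2 + 13 * u + 49) * (u ^ 2 + 5 * u + 1) ^ 3 * W.Δ) = 0 := by
    linear_combination u * A3 + υ ^ 18 * hu - ((u ^ 2 + 13 * u + 49) * (u ^ 2 + 5 * u + 1) ^ 3) * hΔ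
  have := (mul_eq_zero.1 key).resolve_left (pow_ne_zero 12 hw)
  linear_combination this

end Summit.Langlands.Langlands.Theorems.SqrtFiveQuarticCovers

end
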